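import Summits.MatrixMultiplication.OmegaCensus.StrongUSPOmegaBound
import Literature.Computability.AlgebraicComplexity.StrongUSPTriangle
import HarnessLib

/-!
# ω-census, family (b′) STPP / USP: CKSU Corollary 3.6 / 16, capacity form, and "Conjecture 3.4 / 14 ⇒ ω = 2"

HONEST FRAMING (pub-omega census; verbatim): lottery ticket; floor = certified bounds/negative ranges.
Census BOOKKEEPING for the Cohn–Umans STPP / USP track, not progress on `ω`.

Cohn–Kleinberg–Szegedy–Umans 2005, Corollary 16 (= Cor. 3.6), second sentence, AS PRINTED: "In particular, if the
strong USP capacity is `C`, then `ω ≤ 3 (log m − log C) / log(m − 1)`."  The strong USP capacity is "the largest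
constant `C` such that there exist strong USPs of size `(C − o(1))^k` and width `k` for infinitely many values of
`k`"; the hypothesis below (`hcap`) is the lower-bound half of "capacity ≥ C" in that language — for every
`0 < C' < C` and every `K` some width `k ≥ K` carries a strong USP with at least `C'^k` rows — which is all the
corollary uses.  Proof as printed (substitute into the first sentence, `omega_le_of_isStrongUSP`, and let
`k → ∞`, `C' → C`; the only analysis is `log s! ≥ s log s − s`).

Then CKSU Conjecture 14 (= Conj. 3.4: "The strong USP capacity equals `3/2^{2/3}`") ⇒ `ω = 2` ("Corollary 16
yields `ω = 2` upon taking `m = 3`"): `omega_le_two_of_strongUSPCapacity` — a CONDITIONAL theorem; the conjecture is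
open (and the tree's `ω ≥ 2` makes the conclusion `ω = 2`).

## References
* H. Cohn, R. Kleinberg, B. Szegedy, C. Umans, *Group-theoretic algorithms for matrix multiplication*, FOCS 2005;
  arXiv:math/0511460, §3.2–3.3: Conjecture 14, Corollary 16 and the two sentences after it (p. 6).
  [CohnKleinbergSzegedyUmans2005]
-/

noncomputable section

namespace Summit.MatrixMultiplication.OmegaCensus

open Literature.Computability.AlgebraicComplexity

/-- Stirling from below: `s log s ≤ log s! + s`. [folklore] -/
private theorem mul_log_le_log_factorial_add' (s : ℕ) :
    (s : ℝ) * Real.log s ≤ Real.log (Nat.factorial s : ℕ) + s := by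
  have hf : (0 : ℝ) < (Nat.factorial s : ℕ) := by exact_mod_cast Nat.factorial_pos s
  have h := Real.pow_div_factorial_le_exp (s : ℝ) (Nat.cast_nonneg s) s
  rw [div_le_iff₀ hf] at h
  rcases Nat.eq_zero_or_pos s with hs | hs
  · subst hs; simp
  have hpos : (0 : ℝ) < (s : ℝ) ^ s := by positivity
  have hlog := Real.log_le_log hpos h
  rw [Real.log_pow, Real.log_mul (Real.exp_pos _).ne' hf.ne', Real.log_exp] at hlog
  linarith

/-- One strong USP with `C'^k ≤ s` rows, width `k ≥ 1`, `0 < C'`: `ω ≤ 3 (log m − log C' + 1/k) / log(m − 1)`.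
[cite: CohnKleinbergSzegedyUmans2005, Corollary 16 (§3.3), proof of the second sentence] -/
theorem omega_le_of_isStrongUSP_card_ge_pow {s k : ℕ} {row : Fin s → Fin k → Fin 3} (hU : IsStrongUSP row)
    (hk : 1 ≤ k) {C' : ℝ} (hC' : 0 < C') (hs : C' ^ k ≤ (s : ℝ)) {m : ℕ} (hm : 3 ≤ m) :
    omega ℂ ≤ 3 * (Real.log m - Real.log C' + 1 / k) / Real.log ((m : ℝ) - 1) := by
  have hSpos : (0 : ℝ) < s := lt_of_lt_of_le (pow_pos hC' k) hs
  have hspos : 0 < s := by exact_mod_cast hSpos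
  have h0 := omega_le_of_isStrongUSP hU hspos (by omega) hm
  have hkpos : (0 : ℝ) < k := by exact_mod_cast hk
  have hL : 0 < Real.log ((m : ℝ) - 1) := by
    apply Real.log_pos
    have : (3 : ℝ) ≤ m := by exact_mod_cast hm
    linarith
  have hN : (((s * k : ℕ) : ℝ)) = (s : ℝ) * k := by push_cast; ring
  rw [hN] at h0
  -- log s ≥ k log C'
  have hlogs : (k : ℝ) * Real.log C' ≤ Real.log s := by
    rw [← Real.log_pow]
    exact Real.log_le_log (pow_pos hC' k) hs
  have hfact := mul_log_le_log_factorial_add' s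
  have hfact' : (s : ℝ) * (k * Real.log C') - s ≤ Real.log ((Nat.factorial s : ℕ) : ℝ) := by
    nlinarith [hlogs, hSpos.le]
  refine h0.trans ?_
  rw [div_le_div_iff₀ (by positivity) hL]
  have hkey : (s : ℝ) * k * Real.log m - Real.log ((Nat.factorial s : ℕ) : ℝ) ≤
      (Real.log m - Real.log C' + 1 / k) * ((s : ℝ) * k) := by
    have e : (Real.log m - Real.log C' + 1 / k) * ((s : ℝ) * k) =
        (s : ℝ) * k * Real.log m - ((s : ℝ) * (k * Real.log C') - s) := by
      field_simp; ring
    rw [e]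
    linarith
  nlinarith [hkey, hL]

/-- **CKSU 2005, Corollary 3.6 / 16, second sentence, AS PRINTED**: "if the strong USP capacity is `C`, then
`ω ≤ 3 (log m − log C) / log(m − 1)`" — here from the lower-bound half of "capacity `≥ C`": for every
`0 < C' < C` and every `K` there is a strong USP of some width `k ≥ K` with at least `C'^k` rows.
[cite: CohnKleinbergSzegedyUmans2005, Corollary 16 (§3.3, p. 6)] -/
theorem omega_le_of_strongUSPCapacity_ge {C : ℝ} (hC : 0 < C)
    (hcap : ∀ C' : ℝ, 0 < C' → C' < C → ∀ K : ℕ, ∃ k : ℕ, K ≤ k ∧ ∃ s : ℕ,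
      ∃ row : Fin s → Fin k → Fin 3, IsStrongUSP row ∧ C' ^ k ≤ (s : ℝ))
    {m : ℕ} (hm : 3 ≤ m) :
    omega ℂ ≤ 3 * (Real.log m - Real.log C) / Real.log ((m : ℝ) - 1) := by
  have hL : 0 < Real.log ((m : ℝ) - 1) := by
    apply Real.log_pos
    have : (3 : ℝ) ≤ m := by exact_mod_cast hm
    linarith
  apply le_of_forall_pos_lt_add
  intro ε hε
  -- C' := C · exp(−δ) with 3δ/L = ε/2, and K with 3/(K L) < ε/2
  set δ : ℝ := ε * Real.log ((m : ℝ) - 1) / 6 with hδ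
  have hδpos : 0 < δ := by positivity
  set C' : ℝ := C * Real.exp (-δ) with hC'def
  have hC'pos : 0 < C' := by positivity
  have hC'lt : C' < C := by
    have : Real.exp (-δ) < 1 := Real.exp_lt_one_iff.mpr (by linarith)
    calc C' = C * Real.exp (-δ) := rfl
      _ < C * 1 := by exact mul_lt_mul_of_pos_left this hC
      _ = C := mul_one C
  have hlogC' : Real.log C' = Real.log C - δ := by
    rw [hC'def, Real.log_mul hC.ne' (Real.exp_pos _).ne', Real.log_exp]; ring
  obtain ⟨K, hK⟩ := exists_nat_gt (6 / (ε * Real.log ((m : ℝ) - 1)))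
  have hKpos : (0 : ℝ) < K := lt_of_le_of_lt (by positivity) hK
  obtain ⟨k, hKk, s, row, hU, hs⟩ := hcap C' hC'pos hC'lt (max K 1)
  have hk1 : 1 ≤ k := le_trans (le_max_right _ _) hKk
  have hkK : K ≤ k := le_trans (le_max_left _ _) hKk
  have hkpos : (0 : ℝ) < k := by exact_mod_cast hk1
  have h := omega_le_of_isStrongUSP_card_ge_pow hU hk1 hC'pos hs hm
  rw [hlogC'] at h
  -- 3 (log m − log C + δ + 1/k)/L = 3(log m − log C)/L + 3δ/L + 3/(k L)
  have hsplit : 3 * (Real.log m - (Real.log C - δ) + 1 / k) / Real.log ((m : ℝ) - 1) =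
      3 * (Real.log m - Real.log C) / Real.log ((m : ℝ) - 1) + 3 * δ / Real.log ((m : ℝ) - 1)
        + 3 / (k * Real.log ((m : ℝ) - 1)) := by
    field_simp
    ring
  rw [hsplit] at h
  have h1 : 3 * δ / Real.log ((m : ℝ) - 1) = ε / 2 := by
    rw [hδ]; field_simp; ring
  have h2 : 3 / (k * Real.log ((m : ℝ) - 1)) < ε / 2 := by
    rw [div_lt_iff₀ (by positivity)]
    rw [div_lt_iff₀ (by positivity)] at hK
    have hkK' : (K : ℝ) ≤ k := by exact_mod_cast hkK
    nlinarith [hK, hL, hε, hkK']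
  linarith

/-- **CKSU 2005: Conjecture 3.4 / 14 ("the strong USP capacity equals `3/2^{2/3}`") implies `ω = 2`** ("Corollary 16
yields `ω = 2` upon taking `m = 3`"), as the conditional `ω ≤ 2` from the lower-bound half of the conjecture (with the
tree's `two_le_omega` this is `ω = 2`).  The conjecture is OPEN; this theorem is the printed implication only.
[cite: CohnKleinbergSzegedyUmans2005, Conjecture 14 (§3.2) and the sentence after Corollary 16 (§3.3, p. 6)] -/
theorem omega_le_two_of_strongUSPCapacity
    (hconj : ∀ C' : ℝ, 0 < C' → C' < 3 / (2 : ℝ) ^ (2 / 3 : ℝ) → ∀ K : ℕ, ∃ k : ℕ, K ≤ k ∧ ∃ s : ℕ,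
      ∃ row : Fin s → Fin k → Fin 3, IsStrongUSP row ∧ C' ^ k ≤ (s : ℝ)) :
    omega ℂ ≤ 2 := by
  have hCpos : 0 < 3 / (2 : ℝ) ^ (2 / 3 : ℝ) := by positivity
  have h := omega_le_of_strongUSPCapacity_ge hCpos hconj (m := 3) (by norm_num)
  have hlogC : Real.log (3 / (2 : ℝ) ^ (2 / 3 : ℝ)) = Real.log 3 - 2 / 3 * Real.log 2 := by
    rw [Real.log_div (by norm_num) (by positivity), Real.log_rpow (by norm_num)]
  have h3 : Real.log ((3 : ℕ) : ℝ) = Real.log 3 := by norm_num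
  have h2 : Real.log (((3 : ℕ) : ℝ) - 1) = Real.log 2 := by norm_num
  rw [hlogC, h3, h2] at h
  have hlog2 : 0 < Real.log 2 := Real.log_pos (by norm_num)
  have e : 3 * (Real.log 3 - (Real.log 3 - 2 / 3 * Real.log 2)) / Real.log 2 = 2 := by
    field_simp; ring
  rwa [e] at h

/-- Cross-check of the two routes: CKSU Cor. 16 (capacity form, this file) fed with "capacity `≥ 2^{2/3}`"
(`exists_isStrongUSP_card_ge_pow`, `StrongUSPTriangle.lean`) returns exactly the closed form of
`CKSUTriangleOmegaBound.omega_le_cksu_prop18_limit`: `ω ≤ 3 (log m − (2/3) log 2) / log(m − 1)` for every `m ≥ 3`.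
[cite: CohnKleinbergSzegedyUmans2005, Proposition 18 and Corollary 16 (§3)] -/
theorem omega_le_of_strongUSPCapacity_ge_twoPowTwoThirds {m : ℕ} (hm : 3 ≤ m) :
    omega ℂ ≤ 3 * (Real.log m - 2 / 3 * Real.log 2) / Real.log ((m : ℝ) - 1) := by
  have hC : 0 < (2 : ℝ) ^ (2 / 3 : ℝ) := by positivity
  have h := omega_le_of_strongUSPCapacity_ge hC
    (fun C' hC'0 hC'lt K => by
      obtain ⟨k, hk, s, row, hU, hs⟩ := exists_isStrongUSP_card_ge_pow C' hC'0.le hC'lt K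
      exact ⟨k, hk, s, row, hU, hs⟩) hm
  rwa [Real.log_rpow (by norm_num)] at h

end Summit.MatrixMultiplication.OmegaCensus

end
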